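import Summits.AtomisticToContinuum.FouriersLaw.Theses.OddSectorIrreversibility
import Summits.AtomisticToContinuum.FouriersLaw.Theses.ParabolicBathMap
import Summits.AtomisticToContinuum.FouriersLaw.Theses.FeketeSeriesLaw
import Summits.AtomisticToContinuum.FouriersLaw.Theses.JunctionLocality

/-!
# Stub `stub_upperIncrement` (U), helper I — STATUS: blocked (no `N`-uniform length comparison of the pinned
# chain's steady-state responses exists in the tree); the reductions to the named items that DO imply
# it are proved here, sorry-free

Crux `stmt-AtomisticToContinuum-9141` (`OddSectorIrreversibility.BoundedResponseConverges`), line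
`two-scale-gluing-log-rigidity`, registered stub `stub_upperIncrement` (U): under the crux's prefix
(parameters `> 0`, weak-NESS uniqueness, a steady family, `T > 0`, response coefficients `D`) and
`0 < D N` for `N ≥ 2`,
`∃ C N₀, ∀ N ≥ N₀, (((N+1 : ℕ) : ℝ) - 1)/D (N+1) ≤ ((N : ℝ) - 1)/D N + C` — one more bead costs at most
`C` bath-to-bath resistance (`R_N := (N-1)/D_N`, `R_{N+1} ≤ R_N + C` eventually).

This file does NOT declare the stub (it is an `N`-UNIFORM comparison between the NESS responses of the
chains of lengths `N` and `N + 1`; nothing of the kind is proved in the tree for the anharmonic chain,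
and nothing is in print: BonettoLebowitzReyBellet2000 §6.3). What it contains, kernel-checked:

* `increment_of_tendsto_sub` — sequence level: convergent resistance increments ⇒ the (U)-shape
  (`C = r + 1`).
* `increment_of_twoSided` — sequence level: quasi-SUBadditivity `R_{N+M} ≤ R_N + R_M + C` and
  quasi-SUPERadditivity `R_N + R_M - C' ≤ R_{N+M}` on `{N, M ≥ 2}` together give the one-step bound
  `R_{N+1} ≤ R_N + (R_3 - R_2 + C + C')` for `N ≥ 2` (use `M = 3` in the first, `(N+1, 2)` in the
  second; neither half alone controls a ONE-site increment, both only see `M ≥ 2`).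
* `upperIncrement_of_bathOrbitParabolic` — the single existing named item that implies (U) verbatim:
  `ParabolicBathMap.BathOrbitParabolic` (stmt-AtomisticToContinuum-11919, the TARGET of route
  ParabolicBathMap: under uniqueness the increments `1/G_{N+1} - 1/G_N` of every conductance sequence
  `G_N = D_N/(N-1)` converge to `r > 0`) ⇒ (U) with `C = r + 1` (the positivity hypothesis of (U) is
  not even used).
* `upperIncrement_of_recurrence_of_parabolicGerm` — the same through that route's cruxes
  `ParabolicBathMap.Recurrence` (stmt-11923, `G_N → 0`) and `ParabolicBathMap.ParabolicGerm`
  (stmt-11921, increments converge GIVEN `G_N → 0` and `G_N > 0`); here (U)'s positivity hypothesis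
  supplies `G_N > 0`.
* `upperIncrement_of_quasiSubadditive_of_superadditive` — (U) from the two junction-locality cruxes of
  the series-law routes, `FeketeSeriesLaw.QuasiSubadditiveResistance` (stmt-14041) and
  `JunctionLocality.SuperadditiveResistance` (stmt-11748), via `increment_of_twoSided`.

All five are implications between tree declarations (no new `def`, no vendored fact); the three
chain-level ones have the registered signature of `stub_upperIncrement` as their conclusion VERBATIM,
so `theorem stub_upperIncrement := upperIncrement_of_bathOrbitParabolic h` closes the stub the day
stmt-11919 (or 11921 + 11923, or 14041 + 11748) is proved. The weakest chain-specific input known to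
suffice remains eventual monotonicity `D_N ≤ D_{N+1}` (`increment_of_monotone` in the line's skeleton,
`C = 1/D_{N₀}`); it is not a tree item.
-/

noncomputable section

namespace Summit.AtomisticToContinuum.FouriersLaw.Cruxes.BoundedResponseConverges.TwoScaleGluingLogRigidity.Stubs

open Filter Topology
open Literature.MathematicalPhysics.KineticTheory.HeatConduction

/-! ## Sequence-level cores -/

/-- Convergent one-step increments are eventually bounded above: if `R (N+1) - R N → r` then
`R (N+1) ≤ R N + (r + 1)` for all large `N`. [folklore] -/
theorem increment_of_tendsto_sub {R : ℕ → ℝ} {r : ℝ}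
    (h : Tendsto (fun N : ℕ => R (N + 1) - R N) atTop (𝓝 r)) :
    ∃ C : ℝ, ∃ N₀ : ℕ, ∀ N : ℕ, N₀ ≤ N → R (N + 1) ≤ R N + C := by
  obtain ⟨N₀, hN₀⟩ := eventually_atTop.1 (h.eventually (gt_mem_nhds (lt_add_one r)))
  exact ⟨r + 1, N₀, fun N hN => by linarith [hN₀ N hN]⟩

/-- Two-sided junction locality on `{N, M ≥ 2}` controls the ONE-site increment: from
`R (N+M) ≤ R N + R M + C` (with `M = 3`) and `R N + R M - C' ≤ R (N+M)` (at `(N+1, 2)`),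
`R (N+1) ≤ R (N+3) - R 2 + C' ≤ R N + (R 3 - R 2 + C + C')` for every `N ≥ 2`. [folklore] -/
theorem increment_of_twoSided {R : ℕ → ℝ} {C C' : ℝ}
    (hsub : ∀ N M : ℕ, 2 ≤ N → 2 ≤ M → R (N + M) ≤ R N + R M + C)
    (hsup : ∀ N M : ℕ, 2 ≤ N → 2 ≤ M → R N + R M - C' ≤ R (N + M)) :
    ∀ N : ℕ, 2 ≤ N → R (N + 1) ≤ R N + (R 3 - R 2 + C + C') := by
  intro N hN
  have h1 : R (N + 3) ≤ R N + R 3 + C := hsub N 3 hN (by norm_num)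
  have h2 : R (N + 1) + R 2 - C' ≤ R (N + 1 + 2) := hsup (N + 1) 2 (by omega) le_rfl
  have e : N + 1 + 2 = N + 3 := rfl
  rw [e] at h2
  linarith

/-! ## (U) from `ParabolicBathMap.BathOrbitParabolic` (stmt-AtomisticToContinuum-11919) -/

/-- **(U) ⇐ `BathOrbitParabolic`.** If, under weak-NESS uniqueness, the resistance increments
`1/G_{N+1} - 1/G_N` of every conductance sequence `G` (`G_N = lim_δ totalCurrent/((N-1)δ)`, `N ≥ 2`)
along every steady family converge to some `r > 0` (route ParabolicBathMap's target, stmt-11919), then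
the registered stub `stub_upperIncrement` holds: with `G_N := D_N/(N-1)` one has `1/G_N = (N-1)/D_N`,
so the increments of `R_N = (N-1)/D_N` converge and are eventually `≤ r + 1`. The conclusion below is
the stub's registered signature verbatim. [folklore] -/
theorem upperIncrement_of_bathOrbitParabolic :
    Summit.AtomisticToContinuum.FouriersLaw.Theses.ParabolicBathMap.BathOrbitParabolic →
    ∀ ω₂ lam β γ : ℝ, 0 < ω₂ → 0 < lam → 0 < β → 0 < γ →
    (∀ (N : ℕ) (T_L T_R : ℝ), 0 < T_L → 0 < T_R →
      ∀ μ ν : MeasureTheory.Measure (Literature.MathematicalPhysics.KineticTheory.HeatConduction.PhaseSpace N),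
        (Literature.MathematicalPhysics.KineticTheory.HeatConduction.pinnedChain ω₂ lam β γ).IsSteadyState N T_L T_R μ →
        (Literature.MathematicalPhysics.KineticTheory.HeatConduction.pinnedChain ω₂ lam β γ).IsSteadyState N T_L T_R ν →
        μ = ν) →
    ∀ μ : (N : ℕ) → ℝ → ℝ →
        MeasureTheory.Measure (Literature.MathematicalPhysics.KineticTheory.HeatConduction.PhaseSpace N),
    (∀ (N : ℕ) (T_L T_R : ℝ), 0 < T_L → 0 < T_R →
      (Literature.MathematicalPhysics.KineticTheory.HeatConduction.pinnedChain ω₂ lam β γ).IsSteadyState N T_L T_R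
        (μ N T_L T_R)) →
    ∀ T : ℝ, 0 < T → ∀ D : ℕ → ℝ,
    (∀ N : ℕ, Filter.Tendsto (fun δ : ℝ =>
        (Literature.MathematicalPhysics.KineticTheory.HeatConduction.pinnedChain ω₂ lam β γ).totalCurrent
          (μ N (T + δ / 2) (T - δ / 2)) / δ) (nhdsWithin 0 {(0 : ℝ)}ᶜ) (nhds (D N))) →
    (∀ N : ℕ, 2 ≤ N → 0 < D N) →
    ∃ C : ℝ, ∃ N₀ : ℕ, ∀ N : ℕ, N₀ ≤ N →
      (((N + 1 : ℕ) : ℝ) - 1) / D (N + 1) ≤ ((N : ℝ) - 1) / D N + C := by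
  intro hX ω₂ lam β γ hω hl hβ hγ hUniq μ hμ T hT D hD _hpos
  obtain ⟨r, _hr, hfam⟩ := hX ω₂ lam β γ hω hl hβ hγ hUniq T hT
  -- the conductance sequence `G_N = D_N/(N-1)` has the required `δ`-limits
  have hG : ∀ N : ℕ, 2 ≤ N → Tendsto (fun δ : ℝ =>
      (pinnedChain ω₂ lam β γ).totalCurrent (μ N (T + δ / 2) (T - δ / 2)) / (((N : ℝ) - 1) * δ))
      (𝓝[≠] 0) (𝓝 (D N / ((N : ℝ) - 1))) := by
    intro N _hN
    refine ((hD N).div_const ((N : ℝ) - 1)).congr' (Eventually.of_forall fun δ => ?_)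
    show (pinnedChain ω₂ lam β γ).totalCurrent (μ N (T + δ / 2) (T - δ / 2)) / δ / ((N : ℝ) - 1) =
      (pinnedChain ω₂ lam β γ).totalCurrent (μ N (T + δ / 2) (T - δ / 2)) / (((N : ℝ) - 1) * δ)
    rw [div_div, mul_comm]
  have hlim := hfam μ hμ (fun N => D N / ((N : ℝ) - 1)) hG
  -- `1/G_N = R_N`
  have hlim' : Tendsto (fun N : ℕ => (((N + 1 : ℕ) : ℝ) - 1) / D (N + 1) - ((N : ℝ) - 1) / D N)
      atTop (𝓝 r) := by
    refine hlim.congr' (Eventually.of_forall fun N => ?_)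
    show (D (N + 1) / (((N + 1 : ℕ) : ℝ) - 1))⁻¹ - (D N / ((N : ℝ) - 1))⁻¹ =
      (((N + 1 : ℕ) : ℝ) - 1) / D (N + 1) - ((N : ℝ) - 1) / D N
    rw [inv_div, inv_div]
  exact increment_of_tendsto_sub (R := fun N : ℕ => ((N : ℝ) - 1) / D N) hlim'

/-! ## (U) from `ParabolicBathMap.Recurrence` + `ParabolicBathMap.ParabolicGerm` (stmt-11923, 11921) -/

/-- **(U) ⇐ `Recurrence` + `ParabolicGerm`.** Along the given steady family the conductances
`G_N := D_N/(N-1)` tend to `0` (`Recurrence`, stmt-11923) and are positive for `N ≥ 2` (the stub's own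
hypothesis), so `ParabolicGerm` (stmt-11921) makes the increments `1/G_{N+1} - 1/G_N = R_{N+1} - R_N`
converge; hence they are eventually `≤ r + 1`. Conclusion = the registered signature of
`stub_upperIncrement` verbatim. [folklore] -/
theorem upperIncrement_of_recurrence_of_parabolicGerm :
    Summit.AtomisticToContinuum.FouriersLaw.Theses.ParabolicBathMap.Recurrence →
    Summit.AtomisticToContinuum.FouriersLaw.Theses.ParabolicBathMap.ParabolicGerm →
    ∀ ω₂ lam β γ : ℝ, 0 < ω₂ → 0 < lam → 0 < β → 0 < γ →
    (∀ (N : ℕ) (T_L T_R : ℝ), 0 < T_L → 0 < T_R →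
      ∀ μ ν : MeasureTheory.Measure (Literature.MathematicalPhysics.KineticTheory.HeatConduction.PhaseSpace N),
        (Literature.MathematicalPhysics.KineticTheory.HeatConduction.pinnedChain ω₂ lam β γ).IsSteadyState N T_L T_R μ →
        (Literature.MathematicalPhysics.KineticTheory.HeatConduction.pinnedChain ω₂ lam β γ).IsSteadyState N T_L T_R ν →
        μ = ν) →
    ∀ μ : (N : ℕ) → ℝ → ℝ →
        MeasureTheory.Measure (Literature.MathematicalPhysics.KineticTheory.HeatConduction.PhaseSpace N),
    (∀ (N : ℕ) (T_L T_R : ℝ), 0 < T_L → 0 < T_R →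
      (Literature.MathematicalPhysics.KineticTheory.HeatConduction.pinnedChain ω₂ lam β γ).IsSteadyState N T_L T_R
        (μ N T_L T_R)) →
    ∀ T : ℝ, 0 < T → ∀ D : ℕ → ℝ,
    (∀ N : ℕ, Filter.Tendsto (fun δ : ℝ =>
        (Literature.MathematicalPhysics.KineticTheory.HeatConduction.pinnedChain ω₂ lam β γ).totalCurrent
          (μ N (T + δ / 2) (T - δ / 2)) / δ) (nhdsWithin 0 {(0 : ℝ)}ᶜ) (nhds (D N))) →
    (∀ N : ℕ, 2 ≤ N → 0 < D N) →
    ∃ C : ℝ, ∃ N₀ : ℕ, ∀ N : ℕ, N₀ ≤ N →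
      (((N + 1 : ℕ) : ℝ) - 1) / D (N + 1) ≤ ((N : ℝ) - 1) / D N + C := by
  intro hRec hGerm ω₂ lam β γ hω hl hβ hγ hUniq μ hμ T hT D hD hpos
  obtain ⟨r, hfam⟩ := hGerm ω₂ lam β γ hω hl hβ hγ hUniq T hT
  have hG : ∀ N : ℕ, 2 ≤ N → Tendsto (fun δ : ℝ =>
      (pinnedChain ω₂ lam β γ).totalCurrent (μ N (T + δ / 2) (T - δ / 2)) / (((N : ℝ) - 1) * δ))
      (𝓝[≠] 0) (𝓝 (D N / ((N : ℝ) - 1))) := by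
    intro N _hN
    refine ((hD N).div_const ((N : ℝ) - 1)).congr' (Eventually.of_forall fun δ => ?_)
    show (pinnedChain ω₂ lam β γ).totalCurrent (μ N (T + δ / 2) (T - δ / 2)) / δ / ((N : ℝ) - 1) =
      (pinnedChain ω₂ lam β γ).totalCurrent (μ N (T + δ / 2) (T - δ / 2)) / (((N : ℝ) - 1) * δ)
    rw [div_div, mul_comm]
  have hzero : Tendsto (fun N : ℕ => D N / ((N : ℝ) - 1)) atTop (𝓝 0) :=
    hRec ω₂ lam β γ hω hl hβ hγ hUniq μ hμ T hT (fun N => D N / ((N : ℝ) - 1)) hG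
  have hGpos : ∀ N : ℕ, 2 ≤ N → 0 < D N / ((N : ℝ) - 1) := by
    intro N hN
    have h2 : (2 : ℝ) ≤ N := by exact_mod_cast hN
    exact div_pos (hpos N hN) (by linarith)
  have hlim := hfam μ hμ (fun N => D N / ((N : ℝ) - 1)) hG hzero hGpos
  have hlim' : Tendsto (fun N : ℕ => (((N + 1 : ℕ) : ℝ) - 1) / D (N + 1) - ((N : ℝ) - 1) / D N)
      atTop (𝓝 r) := by
    refine hlim.congr' (Eventually.of_forall fun N => ?_)
    show (D (N + 1) / (((N + 1 : ℕ) : ℝ) - 1))⁻¹ - (D N / ((N : ℝ) - 1))⁻¹ =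
      (((N + 1 : ℕ) : ℝ) - 1) / D (N + 1) - ((N : ℝ) - 1) / D N
    rw [inv_div, inv_div]
  exact increment_of_tendsto_sub (R := fun N : ℕ => ((N : ℝ) - 1) / D N) hlim'

/-! ## (U) from `FeketeSeriesLaw.QuasiSubadditiveResistance` + `JunctionLocality.SuperadditiveResistance`
(stmt-14041, 11748) -/

/-- **(U) ⇐ two-sided junction locality.** Quasi-subadditivity of the bath-to-bath resistance
(`FeketeSeriesLaw.QuasiSubadditiveResistance`, stmt-14041: `R_{N+M} ≤ R_N + R_M + C`, `N, M ≥ 2`) and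
its quasi-superadditivity (`JunctionLocality.SuperadditiveResistance`, stmt-11748:
`R_N + R_M - C' ≤ R_{N+M}`, `N, M ≥ 2`) give `R_{N+1} ≤ R_N + (R_3 - R_2 + C + C')` for `N ≥ 2`
(`increment_of_twoSided`). Conclusion = the registered signature of `stub_upperIncrement` verbatim.
[folklore] -/
theorem upperIncrement_of_quasiSubadditive_of_superadditive :
    Summit.AtomisticToContinuum.FouriersLaw.Theses.FeketeSeriesLaw.QuasiSubadditiveResistance →
    Summit.AtomisticToContinuum.FouriersLaw.Theses.JunctionLocality.SuperadditiveResistance →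
    ∀ ω₂ lam β γ : ℝ, 0 < ω₂ → 0 < lam → 0 < β → 0 < γ →
    (∀ (N : ℕ) (T_L T_R : ℝ), 0 < T_L → 0 < T_R →
      ∀ μ ν : MeasureTheory.Measure (Literature.MathematicalPhysics.KineticTheory.HeatConduction.PhaseSpace N),
        (Literature.MathematicalPhysics.KineticTheory.HeatConduction.pinnedChain ω₂ lam β γ).IsSteadyState N T_L T_R μ →
        (Literature.MathematicalPhysics.KineticTheory.HeatConduction.pinnedChain ω₂ lam β γ).IsSteadyState N T_L T_R ν →
        μ = ν) →
    ∀ μ : (N : ℕ) → ℝ → ℝ →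
        MeasureTheory.Measure (Literature.MathematicalPhysics.KineticTheory.HeatConduction.PhaseSpace N),
    (∀ (N : ℕ) (T_L T_R : ℝ), 0 < T_L → 0 < T_R →
      (Literature.MathematicalPhysics.KineticTheory.HeatConduction.pinnedChain ω₂ lam β γ).IsSteadyState N T_L T_R
        (μ N T_L T_R)) →
    ∀ T : ℝ, 0 < T → ∀ D : ℕ → ℝ,
    (∀ N : ℕ, Filter.Tendsto (fun δ : ℝ =>
        (Literature.MathematicalPhysics.KineticTheory.HeatConduction.pinnedChain ω₂ lam β γ).totalCurrent
          (μ N (T + δ / 2) (T - δ / 2)) / δ) (nhdsWithin 0 {(0 : ℝ)}ᶜ) (nhds (D N))) →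
    (∀ N : ℕ, 2 ≤ N → 0 < D N) →
    ∃ C : ℝ, ∃ N₀ : ℕ, ∀ N : ℕ, N₀ ≤ N →
      (((N + 1 : ℕ) : ℝ) - 1) / D (N + 1) ≤ ((N : ℝ) - 1) / D N + C := by
  intro hSub hSup ω₂ lam β γ hω hl hβ hγ hUniq μ hμ T hT D hD hpos
  obtain ⟨C, hC⟩ := hSub ω₂ lam β γ hω hl hβ hγ hUniq μ hμ T hT D hD
  obtain ⟨C', hC'⟩ := hSup ω₂ lam β γ hω hl hβ hγ hUniq μ hμ T hT D hD hpos
  set R : ℕ → ℝ := fun N => ((N : ℝ) - 1) / D N with hRdef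
  have hsub : ∀ N M : ℕ, 2 ≤ N → 2 ≤ M → R (N + M) ≤ R N + R M + C := by
    intro N M hN hM
    have h := hC N M hN hM
    have e1 : ((N + M - 1 : ℕ) : ℝ) = ((N + M : ℕ) : ℝ) - 1 := by
      rw [Nat.cast_sub (by omega), Nat.cast_one]
    have e2 : ((N - 1 : ℕ) : ℝ) = (N : ℝ) - 1 := by
      rw [Nat.cast_sub (by omega), Nat.cast_one]
    have e3 : ((M - 1 : ℕ) : ℝ) = (M : ℝ) - 1 := by
      rw [Nat.cast_sub (by omega), Nat.cast_one]
    rw [e1, e2, e3] at h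
    exact h
  have hsup : ∀ N M : ℕ, 2 ≤ N → 2 ≤ M → R N + R M - C' ≤ R (N + M) := by
    intro N M hN hM
    have h := hC' N M hN hM
    have e : ((N : ℝ) + (M : ℝ) - 1) = ((N + M : ℕ) : ℝ) - 1 := by push_cast; ring
    rw [e] at h
    exact h
  refine ⟨R 3 - R 2 + C + C', 2, fun N hN => ?_⟩
  exact increment_of_twoSided hsub hsup N hN

end Summit.AtomisticToContinuum.FouriersLaw.Cruxes.BoundedResponseConverges.TwoScaleGluingLogRigidity.Stubs

end
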